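/-
Copyright: the b2b-balaban T⁴-continuum CRUX team, row NE7b OWNER lineage `t4-ne7b-p1` (gen 107). Project licence.
-/
import Summits.QuantumFields.BalabanUV.T4Continuum.Spine.NE7b.ConvexTiltMoment
import Summits.QuantumFields.BalabanUV.T4Continuum.Spine.NE7b.ConvexWindowBrascampLieb
import Summits.QuantumFields.BalabanUV.T4Continuum.Spine.NE7b.CarrierOnSupport

/-!
# THE CONVEXITY ROAD ON A CONVEX WINDOW, WITHOUT EXTENSION OR MASS FRACTION:
# `∫_K e^{−V} ≤ exp(Σ_k q_k(λ⁻¹‖u_k‖² + m_k²)) · ∫_K e^{−(V+g)}` for `K` CONVEX, `V` `λ`-uniformly convex ON `K` ONLY, `m_k` the WINDOWED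
# tilted means (row NE7b, node U5c; residual (R2′) family (2); the refuter's σ-ne7bref-g68-2 `exp_moment_le_of_uniformlyConvex_on_convexWindow`)

Cell `pub-balaban`, sub-cell `t4`, spine estimate NE7b (`T4WeightBudget.RelWeightBound`; the cell's OWN estimate — NOT PRINTED in
[Bałaban 1983–89], NOT PROVED).  Crux-route work under `Spine/NE7b/` by the row's OWNER; NOTHING of Bałaban's is named or asserted;
no `T4Continuum/Support` leaf typed; no `def`; zero `sorry`.

WHY.  `…NE7b.ConvexTiltMoment` (T-60a′) displays the convexity road with `V` `λ`-uniformly convex on the WHOLE carrier; its §4 carries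
a window `K` only through a whole-carrier extension plus a mass-fraction divisor `1∕(1−η)`, and its tilted means are the UNWINDOWED
ones.  Print's exponents are convex on their small-field windows only, and those windows are CONVEX (idea-1 T-61; refuter F397: Δ4-den
CLOSED).  With the windowed Brascamp–Lieb inequality `…NE7b.ConvexWindowBrascampLieb.variance_windowTilted_le` (this gen) the road runs
ON THE WINDOW ITSELF: convexity of `V` is asked between points of `K` only, the Jensen step and the tilted means live under the
windowed tilt `ν_{V,K} = 1_K e^{−V}dx ∕ ∫_K e^{−V}`, and no mass fraction is paid.  This is the refuter's σ-ne7bref-g68-2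
(PRICING-NE7b v72 F395 (Q1)(b)) AS A THEOREM.

WHAT IS PROVED ([folklore]; the windowed Brascamp–Lieb inequality and the owner's Jensen step BY NAME):
* §1 **`sq_moment_inner_le_on_convexWindow`**: `∫⟪u,x⟫² dν_{V,K} ≤ λ⁻¹‖u‖² + (∫⟪u,x⟫ dν_{V,K})²`.
* §2 **`tiltedMean_qf_le_on_convexWindow`**: `∫ Σ_k q_k⟪u_k,x⟫² dν_{V,K} ≤ Σ_k q_k(λ⁻¹‖u_k‖² + m_k²)`, `m_k = ∫⟪u_k,x⟫ dν_{V,K}`.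
* §3 **`exp_moment_le_of_uniformlyConvex_on_convexWindow`**: for `K` convex measurable, `V` continuous on the carrier and
  `λ`-uniformly convex ON `K` (`∀ x ∈ K, ∀ y ∈ K, V x + ⟪∇V x, y − x⟫ + (λ∕2)‖y − x‖² ≤ V y`), `e^{−V}` integrable on `K`, `q_k ≥ 0`,
  first and second windowed tilted moments of the `⟪u_k, ·⟫`:
  `∫_K e^{−V} ≤ exp(Σ_k q_k·(λ⁻¹‖u_k‖² + m_k²)) · ∫_K e^{−(V + Σ_k q_k⟪u_k,·⟫²)}` (a window of volume zero is allowed: both sides vanish).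
* §4 the CENTRED EVEN class on a SYMMETRIC window (`windowTiltedMean_eq_zero_of_even`,
  **`exp_moment_le_of_uniformlyConvex_on_symmConvexWindow_even`**): the windowed tilted means vanish, `exp(Σ_k q_k·λ⁻¹‖u_k‖²)` outright.
* §5 suppliers on a BOUNDED window (`integrableOn_exp_neg_of_isBounded`, `integrable_windowTilted_of_isBounded`): the integrability
  letters are free; **`exp_moment_le_of_uniformlyConvex_on_boundedConvexWindow`** asks only `K` convex measurable bounded, `V`
  continuous and `λ`-uniformly convex on `K`, `q_k ≥ 0`.
* §6 NESTED windows `K_N ⊆ K ⊆ K_D` (numerator's window, CONVEXITY window, denominator's window — refuter κ-ne7bref-g68-3: Δ4-num ∕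
  Δ4-den): `nestedWindowCarrier_le : ∫_{K_N} e^{−V} ∕ ∫_{K_D} e^{−(V+g)} ≤ e^{b}` by monotonicity of the outer integrals, and the junction
  BY NAME **`locCondStability_of_nestedWindowCarrier_on_support`** to `…LocalConditionalStability.LocCondStability` (data per `(j, g, y)`,
  hypotheses ON THE SUPPORT OF THE TERM, budget `y`-uniform) over the gen-105 `locCondStability_of_carrier_le_on_support` — the
  windowed companion of `…ConvexTiltLCS`.

NOT HERE (honest): which windows ∕ exponents ∕ moduli Bałaban's steps produce (Δ4-num = Q-ne7bref-g68-1, answered from print as to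
mechanism in RULING W-ne7bp1-g106-4; the by-value letters remain (A1c)∕(A3) readings); the windowed tilted-mean energies `m_k`
((R1″)-class letter); the junction to `LocCondStability` (the owner's `…NE7b.ConvexTiltLCS` pattern, to be re-run on this display);
anything of Bałaban's.  NE7b NOT PRINTED ∕ NOT PROVED; spine PROVED 0∕9; rung (B)+1 on a FINITE torus — NOT infinite volume, NOT the
mass gap, NOT Clay.
HONEST DEPENDENCY: continuum YM on T⁴ ⇐ BetaPertH ∧ nine spine estimates (0/9 proved); BetaPertH ⇐ (D1) ∧ (D4) ∧ CAP+tail.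
-/

set_option autoImplicit false

noncomputable section

open MeasureTheory Real Finset
open scoped RealInnerProductSpace
open Summit.QuantumFields.BalabanUV.T4Continuum.B16HistoryIndexedRepr Summit.QuantumFields.BalabanUV.T4Continuum.B16HistoryReprChain
open Summit.QuantumFields.BalabanUV.T4Continuum.NE7b.PrefixExtraction Summit.QuantumFields.BalabanUV.T4Continuum.NE7b.LocalConditionalStability
open Summit.QuantumFields.BalabanUV.T4Continuum.NE7b.CarrierOnSupport
open Summit.QuantumFields.BalabanUV.T4Continuum.NE7b.ConvexTiltMoment
open Summit.QuantumFields.BalabanUV.T4Continuum.NE7b.ConvexWindowBrascampLieb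

namespace Summit.QuantumFields.BalabanUV.T4Continuum.NE7b.ConvexWindowTiltMoment

section Road

variable {n : ℕ}

/-! ## §1 Second moments of linear functionals under the windowed tilt -/

/-- **SECOND MOMENT OF A LINEAR FUNCTIONAL UNDER THE WINDOWED `λ`-UNIFORMLY LOG-CONCAVE TILT**: for `K` convex measurable of positive
volume and `V` `λ`-uniformly convex ON `K`, `∫⟪u,x⟫² dν_{V,K} ≤ λ⁻¹‖u‖² + (∫⟪u,x⟫ dν_{V,K})²`, `ν_{V,K} = 1_K e^{−V}dx ∕ ∫_K e^{−V}` —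
`variance_windowTilted_le` at the test function `⟪u, ·⟫` (derivative `innerSL ℝ u`, of norm `‖u‖`). [folklore] -/
theorem sq_moment_inner_le_on_convexWindow {V : EuclideanSpace ℝ (Fin n) → ℝ} {lam : ℝ}
    {K : Set (EuclideanSpace ℝ (Fin n))} (hlam : 0 < lam) (hK : Convex ℝ K) (hKm : MeasurableSet K)
    (hK0 : volume K ≠ 0) (hVc : Continuous V)
    (hV : ∀ x ∈ K, ∀ y ∈ K, V x + ⟪gradient V x, y - x⟫ + lam / 2 * ‖y - x‖ ^ 2 ≤ V y)
    (hZ : IntegrableOn (fun x => exp (-V x)) K) (u : EuclideanSpace ℝ (Fin n))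
    (h1 : Integrable (fun x => ⟪u, x⟫) ((volume.restrict K).tilted fun x => -V x))
    (h2 : Integrable (fun x => ⟪u, x⟫ ^ 2) ((volume.restrict K).tilted fun x => -V x)) :
    ∫ x, ⟪u, x⟫ ^ 2 ∂((volume.restrict K).tilted fun x => -V x) ≤
      lam⁻¹ * ‖u‖ ^ 2 + (∫ x, ⟪u, x⟫ ∂((volume.restrict K).tilted fun x => -V x)) ^ 2 := by
  have ef : (fun x : EuclideanSpace ℝ (Fin n) => ⟪u, x⟫) = ⇑(innerSL ℝ u) := by
    funext x; rw [innerSL_apply_apply]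
  have hf : ContDiff ℝ 1 (fun x : EuclideanSpace ℝ (Fin n) => ⟪u, x⟫) := by
    rw [ef]; exact (innerSL ℝ u).contDiff
  have hD : ∀ x : EuclideanSpace ℝ (Fin n), fderiv ℝ (fun x : EuclideanSpace ℝ (Fin n) => ⟪u, x⟫) x = innerSL ℝ u :=
    fun x => by rw [ef]; exact (innerSL ℝ u).fderiv
  haveI : NeZero (volume.restrict K : Measure (EuclideanSpace ℝ (Fin n))) :=
    ⟨fun h => hK0 (Measure.restrict_eq_zero.1 h)⟩
  haveI : IsProbabilityMeasure ((volume.restrict K).tilted fun x : EuclideanSpace ℝ (Fin n) => -V x) :=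
    isProbabilityMeasure_tilted hZ
  have h3 : Integrable (fun x => ‖fderiv ℝ (fun x : EuclideanSpace ℝ (Fin n) => ⟪u, x⟫) x‖ ^ 2)
      ((volume.restrict K).tilted fun x => -V x) := by
    simp_rw [hD, innerSL_apply_norm]
    exact integrable_const _
  have hvar := variance_windowTilted_le hlam hK hKm hK0 hVc hV hZ hf h1 h2 h3
  simp_rw [hD, innerSL_apply_norm, integral_const, smul_eq_mul] at hvar
  simp only [probReal_univ, one_mul] at hvar
  linarith

/-! ## §2 The windowed tilted mean of the sacrificed form -/

/-- **THE WINDOWED TILTED MEAN OF A SUM OF SQUARES OF LINEAR FUNCTIONALS**: `∫ Σ_k q_k⟪u_k,x⟫² dν_{V,K} ≤ Σ_k q_k·(λ⁻¹‖u_k‖² + m_k²)`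
with `m_k = ∫⟪u_k,x⟫ dν_{V,K}`, for `q_k ≥ 0`. [folklore] -/
theorem tiltedMean_qf_le_on_convexWindow {V : EuclideanSpace ℝ (Fin n) → ℝ} {lam : ℝ} {r : ℕ}
    {K : Set (EuclideanSpace ℝ (Fin n))} (hlam : 0 < lam) (hK : Convex ℝ K) (hKm : MeasurableSet K)
    (hK0 : volume K ≠ 0) (hVc : Continuous V)
    (hV : ∀ x ∈ K, ∀ y ∈ K, V x + ⟪gradient V x, y - x⟫ + lam / 2 * ‖y - x‖ ^ 2 ≤ V y)
    (hZ : IntegrableOn (fun x => exp (-V x)) K) (q : Fin r → ℝ) (hq : ∀ k, 0 ≤ q k)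
    (u : Fin r → EuclideanSpace ℝ (Fin n))
    (h1 : ∀ k, Integrable (fun x => ⟪u k, x⟫) ((volume.restrict K).tilted fun x => -V x))
    (h2 : ∀ k, Integrable (fun x => ⟪u k, x⟫ ^ 2) ((volume.restrict K).tilted fun x => -V x)) :
    ∫ x, ∑ k, q k * ⟪u k, x⟫ ^ 2 ∂((volume.restrict K).tilted fun x => -V x) ≤
      ∑ k, q k * (lam⁻¹ * ‖u k‖ ^ 2 + (∫ x, ⟪u k, x⟫ ∂((volume.restrict K).tilted fun x => -V x)) ^ 2) := by
  rw [integral_finsetSum _ fun k _ => (h2 k).const_mul (q k)]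
  refine Finset.sum_le_sum fun k _ => ?_
  rw [integral_const_mul]
  exact mul_le_mul_of_nonneg_left
    (sq_moment_inner_le_on_convexWindow hlam hK hKm hK0 hVc hV hZ (u k) (h1 k) (h2 k)) (hq k)

/-! ## §3 The convexity road on the convex window, assembled -/

/-- **THE CONVEXITY ROAD ON A CONVEX WINDOW (σ-ne7bref-g68-2 as a theorem).**  For `K` convex and measurable, `V` continuous on the
carrier and `λ`-uniformly convex ON `K` in the first-order sense (`∀ x ∈ K, ∀ y ∈ K, V x + ⟪∇V x, y − x⟫ + (λ∕2)‖y − x‖² ≤ V y`; the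
values of `V` off `K` never enter), `e^{−V}` integrable on `K`, and a sacrificed form `g = Σ_k q_k⟪u_k, ·⟫²` with `q_k ≥ 0` whose linear
functionals have first and second moments under the WINDOWED tilt `ν_{V,K} = 1_K e^{−V}dx ∕ ∫_K e^{−V}`:
`∫_K e^{−V} ≤ exp(Σ_k q_k·(λ⁻¹‖u_k‖² + m_k²)) · ∫_K e^{−(V + g)}`, `m_k = ∫⟪u_k,x⟫ dν_{V,K}`.  No extension of `V` off the window, no
mass-fraction divisor; a window of volume zero is allowed (both sides vanish). [folklore] -/
theorem exp_moment_le_of_uniformlyConvex_on_convexWindow {V : EuclideanSpace ℝ (Fin n) → ℝ} {lam : ℝ} {r : ℕ}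
    {K : Set (EuclideanSpace ℝ (Fin n))} (hlam : 0 < lam) (hK : Convex ℝ K) (hKm : MeasurableSet K)
    (hVc : Continuous V)
    (hV : ∀ x ∈ K, ∀ y ∈ K, V x + ⟪gradient V x, y - x⟫ + lam / 2 * ‖y - x‖ ^ 2 ≤ V y)
    (hZ : IntegrableOn (fun x => exp (-V x)) K) (q : Fin r → ℝ) (hq : ∀ k, 0 ≤ q k)
    (u : Fin r → EuclideanSpace ℝ (Fin n))
    (h1 : ∀ k, Integrable (fun x => ⟪u k, x⟫) ((volume.restrict K).tilted fun x => -V x))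
    (h2 : ∀ k, Integrable (fun x => ⟪u k, x⟫ ^ 2) ((volume.restrict K).tilted fun x => -V x)) :
    ∫ x in K, exp (-V x) ≤
      exp (∑ k, q k * (lam⁻¹ * ‖u k‖ ^ 2 + (∫ x, ⟪u k, x⟫ ∂((volume.restrict K).tilted fun x => -V x)) ^ 2)) *
        ∫ x in K, exp (-(V x + ∑ k, q k * ⟪u k, x⟫ ^ 2)) := by
  by_cases hK0 : volume K = 0
  · have h0 : (volume.restrict K : Measure (EuclideanSpace ℝ (Fin n))) = 0 := Measure.restrict_eq_zero.2 hK0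
    rw [h0, integral_zero_measure, integral_zero_measure, mul_zero]
  haveI : NeZero (volume.restrict K : Measure (EuclideanSpace ℝ (Fin n))) :=
    ⟨fun h => hK0 (Measure.restrict_eq_zero.1 h)⟩
  -- the sacrificed form `g`, non-negative and continuous
  have hg0 : ∀ x : EuclideanSpace ℝ (Fin n), 0 ≤ ∑ k, q k * ⟪u k, x⟫ ^ 2 :=
    fun x => Finset.sum_nonneg fun k _ => mul_nonneg (hq k) (sq_nonneg _)
  have hgc : Continuous fun x : EuclideanSpace ℝ (Fin n) => ∑ k, q k * ⟪u k, x⟫ ^ 2 :=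
    continuous_finsetSum _ fun k _ => continuous_const.mul ((continuous_const.inner continuous_id).pow 2)
  have eρ : ∀ x : EuclideanSpace ℝ (Fin n),
      exp (-(V x + ∑ k, q k * ⟪u k, x⟫ ^ 2)) * exp (∑ k, q k * ⟪u k, x⟫ ^ 2) = exp (-V x) := fun x => by
    rw [← exp_add]; ring_nf
  -- integrabilities for the Jensen step (ρ = e^{−(V+g)}) under the windowed Lebesgue measure
  have hρi : IntegrableOn (fun x : EuclideanSpace ℝ (Fin n) => exp (-(V x + ∑ k, q k * ⟪u k, x⟫ ^ 2))) K :=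
    hZ.mono' (hVc.add hgc).neg.rexp.aestronglyMeasurable (ae_of_all _ fun x => by
      rw [Real.norm_of_nonneg (exp_pos _).le]
      exact exp_le_exp.2 (by linarith [hg0 x]))
  have hZ' : Integrable (fun x : EuclideanSpace ℝ (Fin n) =>
      exp (-(V x + ∑ k, q k * ⟪u k, x⟫ ^ 2)) * exp (∑ k, q k * ⟪u k, x⟫ ^ 2)) (volume.restrict K) := by
    simp_rw [eρ]; exact hZ
  have h2v : ∀ k, Integrable (fun x : EuclideanSpace ℝ (Fin n) => exp (-V x) * ⟪u k, x⟫ ^ 2) (volume.restrict K) :=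
    fun k => by
      have := (integrable_tilted_iff hZ _).1 (h2 k)
      simpa only [smul_eq_mul] using this
  have hgi : Integrable (fun x : EuclideanSpace ℝ (Fin n) =>
      (∑ k, q k * ⟪u k, x⟫ ^ 2) * (exp (-(V x + ∑ k, q k * ⟪u k, x⟫ ^ 2)) * exp (∑ k, q k * ⟪u k, x⟫ ^ 2)))
      (volume.restrict K) := by
    simp_rw [eρ]
    have hsum := integrable_finsetSum Finset.univ fun k _ => (h2v k).const_mul (q k)
    refine hsum.congr (ae_of_all _ fun x => ?_)
    simp only [Finset.sum_mul]
    exact Finset.sum_congr rfl fun k _ => by ring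
  have hpos : 0 < ∫ x in K,
      exp (-(V x + ∑ k, q k * ⟪u k, x⟫ ^ 2)) * exp (∑ k, q k * ⟪u k, x⟫ ^ 2) := by
    simp_rw [eρ]; exact integral_exp_pos hZ
  have key := integral_mul_exp_le_exp_tiltedMean (volume.restrict K) (fun x => (exp_pos _).le) hρi hZ' hgi hpos
  simp_rw [eρ] at key
  refine key.trans (mul_le_mul_of_nonneg_right (exp_le_exp.2 ?_) (integral_nonneg fun x => (exp_pos _).le))
  -- the windowed tilted mean of `g`
  have htilt : (∫ x in K, (∑ k, q k * ⟪u k, x⟫ ^ 2) * exp (-V x)) / ∫ x in K, exp (-V x) =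
      ∫ x, ∑ k, q k * ⟪u k, x⟫ ^ 2 ∂((volume.restrict K).tilted fun x => -V x) := by
    rw [integral_tilted, ← integral_div]
    refine integral_congr_ae (ae_of_all _ fun x => ?_)
    simp only [smul_eq_mul]
    ring
  rw [htilt]
  exact tiltedMean_qf_le_on_convexWindow hlam hK hKm hK0 hVc hV hZ q hq u h1 h2


/-! ## §4 The centred even class on a symmetric window: the windowed tilted means vanish -/

/-- For `V` EVEN and `K` SYMMETRIC (`x ∈ K → −x ∈ K`) and measurable, the windowed first moments vanish:
`∫_K ⟪u, x⟫·e^{−V x} dx = 0` (odd integrand on a symmetric window; Lebesgue measure is invariant under `x ↦ −x`). [folklore] -/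
theorem setIntegral_inner_mul_exp_neg_eq_zero_of_even {V : EuclideanSpace ℝ (Fin n) → ℝ}
    {K : Set (EuclideanSpace ℝ (Fin n))} (hKm : MeasurableSet K) (hKs : ∀ x, x ∈ K → -x ∈ K)
    (hVe : ∀ x, V (-x) = V x) (u : EuclideanSpace ℝ (Fin n)) :
    ∫ x in K, ⟪u, x⟫ * exp (-V x) = 0 := by
  rw [← integral_indicator hKm]
  have hodd : ∀ x : EuclideanSpace ℝ (Fin n),
      K.indicator (fun x => ⟪u, x⟫ * exp (-V x)) (-x) = -K.indicator (fun x => ⟪u, x⟫ * exp (-V x)) x := by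
    intro x
    by_cases hx : x ∈ K
    · rw [Set.indicator_of_mem (hKs x hx), Set.indicator_of_mem hx, inner_neg_right, hVe, neg_mul]
    · have hnx : -x ∉ K := fun h => hx (by simpa using hKs (-x) h)
      rw [Set.indicator_of_notMem hnx, Set.indicator_of_notMem hx, neg_zero]
  have h := integral_neg_eq_self (fun x : EuclideanSpace ℝ (Fin n) => K.indicator (fun x => ⟪u, x⟫ * exp (-V x)) x) volume
  simp only [hodd, integral_neg] at h
  linarith

/-- Hence every linear functional has WINDOWED tilted mean zero, `∫⟪u, x⟫ dν_{V,K} = 0`, for even `V` on a symmetric measurable window.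
[folklore] -/
theorem windowTiltedMean_eq_zero_of_even {V : EuclideanSpace ℝ (Fin n) → ℝ} {K : Set (EuclideanSpace ℝ (Fin n))}
    (hKm : MeasurableSet K) (hKs : ∀ x, x ∈ K → -x ∈ K) (hVe : ∀ x, V (-x) = V x) (u : EuclideanSpace ℝ (Fin n)) :
    ∫ x, ⟪u, x⟫ ∂((volume.restrict K).tilted fun x : EuclideanSpace ℝ (Fin n) => -V x) = 0 := by
  rw [integral_tilted]
  have e : (fun x : EuclideanSpace ℝ (Fin n) =>
      (exp (-V x) / ∫ y in K, exp (-V y)) • ⟪u, x⟫) =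
      fun x => (∫ y in K, exp (-V y))⁻¹ * (⟪u, x⟫ * exp (-V x)) := by
    funext x; rw [smul_eq_mul]; ring
  rw [e, integral_const_mul, setIntegral_inner_mul_exp_neg_eq_zero_of_even hKm hKs hVe u, mul_zero]

/-- **THE CONVEXITY ROAD ON A SYMMETRIC CONVEX WINDOW IN THE CENTRED EVEN CLASS**: for `K` convex, measurable and SYMMETRIC, `V` EVEN,
continuous, `λ`-uniformly convex ON `K`, `e^{−V}` integrable on `K`, and `g = Σ_k q_k⟪u_k,·⟫²` (`q_k ≥ 0`) with displayed windowed tilted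
integrabilities: `∫_K e^{−V} ≤ exp(Σ_k q_k·λ⁻¹‖u_k‖²) · ∫_K e^{−(V+g)}` — the windowed tilted-mean letter vanishes.  (Print's windows
ARE symmetric convex — idea-1 T-61 —, but print's non-abelian exponents are NOT even: the cubic BCH term is odd, refuter κ-ne7bref-g71-2;
this is the MODEL class, the general case pays `m_k` by support or by the virial inequality — `…ConvexWindowTiltCentred`.) [folklore] -/
theorem exp_moment_le_of_uniformlyConvex_on_symmConvexWindow_even {V : EuclideanSpace ℝ (Fin n) → ℝ} {lam : ℝ} {r : ℕ}
    {K : Set (EuclideanSpace ℝ (Fin n))} (hlam : 0 < lam) (hK : Convex ℝ K) (hKm : MeasurableSet K)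
    (hKs : ∀ x, x ∈ K → -x ∈ K) (hVc : Continuous V) (hVe : ∀ x, V (-x) = V x)
    (hV : ∀ x ∈ K, ∀ y ∈ K, V x + ⟪gradient V x, y - x⟫ + lam / 2 * ‖y - x‖ ^ 2 ≤ V y)
    (hZ : IntegrableOn (fun x => exp (-V x)) K) (q : Fin r → ℝ) (hq : ∀ k, 0 ≤ q k)
    (u : Fin r → EuclideanSpace ℝ (Fin n))
    (h1 : ∀ k, Integrable (fun x => ⟪u k, x⟫) ((volume.restrict K).tilted fun x => -V x))
    (h2 : ∀ k, Integrable (fun x => ⟪u k, x⟫ ^ 2) ((volume.restrict K).tilted fun x => -V x)) :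
    ∫ x in K, exp (-V x) ≤ exp (∑ k, q k * (lam⁻¹ * ‖u k‖ ^ 2)) * ∫ x in K, exp (-(V x + ∑ k, q k * ⟪u k, x⟫ ^ 2)) := by
  have h := exp_moment_le_of_uniformlyConvex_on_convexWindow hlam hK hKm hVc hV hZ q hq u h1 h2
  simp_rw [windowTiltedMean_eq_zero_of_even hKm hKs hVe] at h
  simpa using h


/-! ## §5 Suppliers on a BOUNDED window: the integrability letters are free -/

/-- On a BOUNDED window every continuous weight is integrable: `K` bounded, `V` continuous ⟹ `e^{−V}` integrable on `K`. [folklore] -/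
theorem integrableOn_exp_neg_of_isBounded {V : EuclideanSpace ℝ (Fin n) → ℝ} {K : Set (EuclideanSpace ℝ (Fin n))}
    (hKb : Bornology.IsBounded K) (hVc : Continuous V) : IntegrableOn (fun x => exp (-V x)) K :=
  (hVc.neg.rexp.continuousOn.integrableOn_compact hKb.isCompact_closure).mono_set subset_closure

/-- On a BOUNDED window the windowed tilted integrability letters of the road are free: `K` bounded, `V` and `f` continuous ⟹
`f ∈ L¹(ν_{V,K})` (so `h1`, `h2` of the road hold for every `⟪u,·⟫`, `⟪u,·⟫²`). [folklore] -/
theorem integrable_windowTilted_of_isBounded {V f : EuclideanSpace ℝ (Fin n) → ℝ} {K : Set (EuclideanSpace ℝ (Fin n))}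
    (hKb : Bornology.IsBounded K) (hVc : Continuous V) (hf : Continuous f) :
    Integrable f ((volume.restrict K).tilted fun x => -V x) := by
  rw [integrable_tilted_iff (integrableOn_exp_neg_of_isBounded hKb hVc) f]
  have h : Integrable (fun x => exp (-V x) * f x) (volume.restrict K) :=
    ((hVc.neg.rexp.mul hf).continuousOn.integrableOn_compact hKb.isCompact_closure).mono_set subset_closure
  simpa only [smul_eq_mul] using h

/-- **THE ROAD ON A BOUNDED CONVEX WINDOW, LETTER-MINIMAL**: `K` convex, measurable and BOUNDED, `V` continuous and `λ`-uniformly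
convex ON `K`, `q_k ≥ 0` — nothing else: `∫_K e^{−V} ≤ exp(Σ_k q_k·(λ⁻¹‖u_k‖² + m_k²)) · ∫_K e^{−(V+g)}`. [folklore] -/
theorem exp_moment_le_of_uniformlyConvex_on_boundedConvexWindow {V : EuclideanSpace ℝ (Fin n) → ℝ} {lam : ℝ} {r : ℕ}
    {K : Set (EuclideanSpace ℝ (Fin n))} (hlam : 0 < lam) (hK : Convex ℝ K) (hKm : MeasurableSet K)
    (hKb : Bornology.IsBounded K) (hVc : Continuous V)
    (hV : ∀ x ∈ K, ∀ y ∈ K, V x + ⟪gradient V x, y - x⟫ + lam / 2 * ‖y - x‖ ^ 2 ≤ V y)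
    (q : Fin r → ℝ) (hq : ∀ k, 0 ≤ q k) (u : Fin r → EuclideanSpace ℝ (Fin n)) :
    ∫ x in K, exp (-V x) ≤
      exp (∑ k, q k * (lam⁻¹ * ‖u k‖ ^ 2 + (∫ x, ⟪u k, x⟫ ∂((volume.restrict K).tilted fun x => -V x)) ^ 2)) *
        ∫ x in K, exp (-(V x + ∑ k, q k * ⟪u k, x⟫ ^ 2)) :=
  exp_moment_le_of_uniformlyConvex_on_convexWindow hlam hK hKm hVc hV (integrableOn_exp_neg_of_isBounded hKb hVc) q hq u
    (fun _ => integrable_windowTilted_of_isBounded hKb hVc (continuous_const.inner continuous_id))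
    (fun _ => integrable_windowTilted_of_isBounded hKb hVc ((continuous_const.inner continuous_id).pow 2))

end Road

/-! ## §6 NESTED windows `K_N ⊆ K ⊆ K_D` and `LocCondStability` BY NAME for the windowed carrier -/

section OneBackground

variable {n : ℕ}

/-- The nested-window carrier `∫_{K_N} e^{−V} ∕ ∫_{K_D} e^{−(V+g)}` is non-negative. [folklore] -/
theorem nestedWindowCarrier_nonneg (V : EuclideanSpace ℝ (Fin n) → ℝ) {r : ℕ} (q : Fin r → ℝ)
    (u : Fin r → EuclideanSpace ℝ (Fin n)) (KN KD : Set (EuclideanSpace ℝ (Fin n))) :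
    0 ≤ (∫ x in KN, exp (-V x)) / ∫ x in KD, exp (-(V x + ∑ k, q k * ⟪u k, x⟫ ^ 2)) :=
  div_nonneg (integral_nonneg fun _ => (exp_pos _).le) (integral_nonneg fun _ => (exp_pos _).le)

/-- **THE NESTED-WINDOW CARRIER OF ONE BACKGROUND IS AT MOST `e^{b}`.**  Windows `K_N ⊆ K ⊆ K_D`, `K` convex measurable; `V`
continuous on the carrier and `λ`-uniformly convex ON `K`; `e^{−V}` integrable on `K` and `e^{−(V+g)}` integrable on `K_D`; the windowed
tilted moments of the `⟪u_k,·⟫` on `K` and the budget `Σ_k q_k(λ⁻¹‖u_k‖² + m_k²) ≤ b` (`m_k` the `K`-windowed tilted means).  Then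
`∫_{K_N} e^{−V} ∕ ∫_{K_D} e^{−(V+g)} ≤ e^{b}` — the windowed road on `K` and monotonicity of the outer integrals. [folklore] -/
theorem nestedWindowCarrier_le {V : EuclideanSpace ℝ (Fin n) → ℝ} {lam b : ℝ} {r : ℕ}
    {KN K KD : Set (EuclideanSpace ℝ (Fin n))} (hlam : 0 < lam) (hK : Convex ℝ K) (hKm : MeasurableSet K)
    (hNK : KN ⊆ K) (hKD : K ⊆ KD) (hVc : Continuous V)
    (hV : ∀ x ∈ K, ∀ y ∈ K, V x + ⟪gradient V x, y - x⟫ + lam / 2 * ‖y - x‖ ^ 2 ≤ V y)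
    (hZ : IntegrableOn (fun x => exp (-V x)) K) (q : Fin r → ℝ) (hq : ∀ k, 0 ≤ q k)
    (u : Fin r → EuclideanSpace ℝ (Fin n))
    (hZD : IntegrableOn (fun x => exp (-(V x + ∑ k, q k * ⟪u k, x⟫ ^ 2))) KD)
    (h1 : ∀ k, Integrable (fun x => ⟪u k, x⟫) ((volume.restrict K).tilted fun x => -V x))
    (h2 : ∀ k, Integrable (fun x => ⟪u k, x⟫ ^ 2) ((volume.restrict K).tilted fun x => -V x))
    (hb : ∑ k, q k * (lam⁻¹ * ‖u k‖ ^ 2 + (∫ x, ⟪u k, x⟫ ∂((volume.restrict K).tilted fun x => -V x)) ^ 2) ≤ b) :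
    (∫ x in KN, exp (-V x)) / (∫ x in KD, exp (-(V x + ∑ k, q k * ⟪u k, x⟫ ^ 2))) ≤ exp b := by
  refine div_le_of_le_mul₀ (integral_nonneg fun _ => (exp_pos _).le) (exp_pos _).le ?_
  calc ∫ x in KN, exp (-V x) ≤ ∫ x in K, exp (-V x) :=
        setIntegral_mono_set hZ (ae_of_all _ fun _ => (exp_pos _).le) (ae_of_all _ hNK)
    _ ≤ exp (∑ k, q k * (lam⁻¹ * ‖u k‖ ^ 2 + (∫ x, ⟪u k, x⟫ ∂((volume.restrict K).tilted fun x => -V x)) ^ 2)) *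
          ∫ x in K, exp (-(V x + ∑ k, q k * ⟪u k, x⟫ ^ 2)) :=
        exp_moment_le_of_uniformlyConvex_on_convexWindow hlam hK hKm hVc hV hZ q hq u h1 h2
    _ ≤ exp b * ∫ x in KD, exp (-(V x + ∑ k, q k * ⟪u k, x⟫ ^ 2)) :=
        mul_le_mul (exp_le_exp.2 hb)
          (setIntegral_mono_set hZD (ae_of_all _ fun _ => (exp_pos _).le) (ae_of_all _ hKD))
          (integral_nonneg fun _ => (exp_pos _).le) (exp_pos _).le

end OneBackground

section Junction

variable {P : Type} [DecidableEq P] {C : ℕ → Type} {𝒢 : (j : ℕ) → GoodClass (C j)}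

/-- **LCS FOR A BACKGROUND-DEPENDENT NESTED-WINDOW CONVEXITY-ROAD CARRIER, ON THE SUPPORT.**  At every pattern prefix `g` of a level
`j < K` and every background `y` let `M j g y = (∫_{K_N} e^{−V}) ∕ (∫_{K_D} e^{−(V+g)})` for the data at `(j, g, y)` on
`EuclideanSpace ℝ (Fin (n j g))` — windows `K_N j g y ⊆ Kc j g y ⊆ K_D j g y` (numerator's window, CONVEXITY window, denominator's
window), exponent `V j g y`, sacrificed form `Σ_k q_k⟪u_k,·⟫²` with `r j g` terms —; suppose `M j g` is a.e.-strongly measurable and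
ON THE SUPPORT OF THE TERM: the windows are nested, `Kc` is convex and measurable, `V` is continuous and `λ`-uniformly convex ON `Kc`
with the `y`-UNIFORM modulus `lam j g > 0`, the integrabilities hold, and the `y`-UNIFORM budget `Σ_k q_k(λ⁻¹‖u_k‖² + m_k²) ≤ b j g`
(`m_k` the `Kc`-windowed tilted means).  Then `LocCondStability T S K μ ρ₀ M b`, integrability conjunct included. [folklore] -/
theorem locCondStability_of_nestedWindowCarrier_on_support (T : Tower P C 𝒢) (Spat : (j : ℕ) → (Fin j → P) → Finset P)
    (K : ℕ) [∀ j, MeasurableSpace (C j)] (μ : (j : ℕ) → Measure (C j)) (ρ₀ : C 0 → ℝ)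
    (M : (j : ℕ) → (Fin j → P) → C j → ℝ)
    (n r : (j : ℕ) → (Fin j → P) → ℕ)
    (KN Kc KD : (j : ℕ) → (g : Fin j → P) → C j → Set (EuclideanSpace ℝ (Fin (n j g))))
    (V : (j : ℕ) → (g : Fin j → P) → C j → EuclideanSpace ℝ (Fin (n j g)) → ℝ)
    (q : (j : ℕ) → (g : Fin j → P) → C j → Fin (r j g) → ℝ)
    (u : (j : ℕ) → (g : Fin j → P) → C j → Fin (r j g) → EuclideanSpace ℝ (Fin (n j g)))
    (lam b : (j : ℕ) → (Fin j → P) → ℝ) (hρ : (𝒢 0).Gd ρ₀) (h0 : ∀ x, 0 ≤ ρ₀ x)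
    (hM : ∀ j g, j < K → g ∈ admS T Spat j → ∀ y, M j g y =
      (∫ x in KN j g y, exp (-V j g y x)) / ∫ x in KD j g y, exp (-(V j g y x + ∑ k, q j g y k * ⟪u j g y k, x⟫ ^ 2)))
    (hMm : ∀ j g, j < K → g ∈ admS T Spat j → AEStronglyMeasurable (M j g) (μ j))
    (hlam : ∀ j g, j < K → g ∈ admS T Spat j → 0 < lam j g)
    (hKc : ∀ j g, j < K → g ∈ admS T Spat j → ∀ y, T.eterm ρ₀ j g y ≠ 0 → Convex ℝ (Kc j g y))
    (hKcm : ∀ j g, j < K → g ∈ admS T Spat j → ∀ y, T.eterm ρ₀ j g y ≠ 0 → MeasurableSet (Kc j g y))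
    (hNK : ∀ j g, j < K → g ∈ admS T Spat j → ∀ y, T.eterm ρ₀ j g y ≠ 0 → KN j g y ⊆ Kc j g y)
    (hKD : ∀ j g, j < K → g ∈ admS T Spat j → ∀ y, T.eterm ρ₀ j g y ≠ 0 → Kc j g y ⊆ KD j g y)
    (hVc : ∀ j g, j < K → g ∈ admS T Spat j → ∀ y, T.eterm ρ₀ j g y ≠ 0 → Continuous (V j g y))
    (hV : ∀ j g, j < K → g ∈ admS T Spat j → ∀ y, T.eterm ρ₀ j g y ≠ 0 → ∀ x ∈ Kc j g y, ∀ z ∈ Kc j g y,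
      V j g y x + ⟪gradient (V j g y) x, z - x⟫ + lam j g / 2 * ‖z - x‖ ^ 2 ≤ V j g y z)
    (hZ : ∀ j g, j < K → g ∈ admS T Spat j → ∀ y, T.eterm ρ₀ j g y ≠ 0 →
      IntegrableOn (fun x => exp (-V j g y x)) (Kc j g y))
    (hq : ∀ j g, j < K → g ∈ admS T Spat j → ∀ y k, 0 ≤ q j g y k)
    (hZD : ∀ j g, j < K → g ∈ admS T Spat j → ∀ y, T.eterm ρ₀ j g y ≠ 0 →
      IntegrableOn (fun x => exp (-(V j g y x + ∑ k, q j g y k * ⟪u j g y k, x⟫ ^ 2))) (KD j g y))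
    (h1 : ∀ j g, j < K → g ∈ admS T Spat j → ∀ y, T.eterm ρ₀ j g y ≠ 0 → ∀ k,
      Integrable (fun x => ⟪u j g y k, x⟫) ((volume.restrict (Kc j g y)).tilted fun x => -V j g y x))
    (h2 : ∀ j g, j < K → g ∈ admS T Spat j → ∀ y, T.eterm ρ₀ j g y ≠ 0 → ∀ k,
      Integrable (fun x => ⟪u j g y k, x⟫ ^ 2) ((volume.restrict (Kc j g y)).tilted fun x => -V j g y x))
    (hb : ∀ j g, j < K → g ∈ admS T Spat j → ∀ y, T.eterm ρ₀ j g y ≠ 0 →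
      ∑ k, q j g y k * ((lam j g)⁻¹ * ‖u j g y k‖ ^ 2 +
        (∫ x, ⟪u j g y k, x⟫ ∂((volume.restrict (Kc j g y)).tilted fun x => -V j g y x)) ^ 2) ≤ b j g)
    (hint : ∀ j g, j < K → g ∈ admS T Spat j → Integrable (T.eterm ρ₀ j g) (μ j)) :
    LocCondStability T Spat K μ ρ₀ M b := by
  refine locCondStability_of_carrier_le_on_support T Spat K μ ρ₀ M _ hρ h0 hMm (fun j g hj hg y => ?_)
    (fun j g hj hg y hy => ?_) hint
  · rw [hM j g hj hg y]
    exact nestedWindowCarrier_nonneg _ _ _ _ _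
  · rw [hM j g hj hg y]
    exact nestedWindowCarrier_le (hlam j g hj hg) (hKc j g hj hg y hy) (hKcm j g hj hg y hy) (hNK j g hj hg y hy) (hKD j g hj hg y hy) (hVc j g hj hg y hy) (hV j g hj hg y hy) (hZ j g hj hg y hy) _
      (hq j g hj hg y) _ (hZD j g hj hg y hy) (h1 j g hj hg y hy) (h2 j g hj hg y hy) (hb j g hj hg y hy)

end Junction

end Summit.QuantumFields.BalabanUV.T4Continuum.NE7b.ConvexWindowTiltMoment

end
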